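import Summits.CriticalPhenomena.CardyFormulaZ2.Theorems.CardySusyWardParafermionFamiliesToSLESixWeightedGreen
import Summits.CriticalPhenomena.CardyFormulaZ2.Theorems.CardySusyWardParafermionFamiliesToSLESixHalfCRLayer
import Summits.CriticalPhenomena.CardyFormulaZ2.Theorems.CardySusyWardParafermionFamiliesToSLESixTotalSmallLayer

/-!
# The boundary first-moment identity (stub `stub_momentIdentity`, crux stmt-CriticalPhenomena-10814)

Helper file for the crux `CardySusyWard.ParafermionFamiliesToSLESix` (stmt-CriticalPhenomena-10814), line
`strip-anchored-vertex-normalisation` (skeleton r4), registered stub `stub_momentIdentity`: along every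
discretisation family `Λ` of every Dobrushin domain `D` (`IsFamily D Λ`), eventually in `δ`,

`2cos(π/12) · totalVertexSum (Λ δ) δ = wallPlainSum (Λ δ) δ − 2(1 − i) · momentSum (Λ δ) δ`,

i.e. `2cos(π/12) · Σ_{p ∈ S_max} F_δ(p) = Σ_{wall (p,k)} G(p,k) − 2(1−i) · Σ_{wall (p,k)} conj(ẑ_p) coeff_k G(p,k)`
with `S_max` the RANDOM both-faces-inner medial vertices (`IsRandomMV`), `G(p,k)` the corner observable at the
`k`-th corner of `p`, `(p,k)` WALL iff the twin medial vertex across the corner is not in `S_max`.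

Proof (pure glue over three landed facts).  Fix admissible data `E = Λ δ` with `E.Ω = D.carrier` and a
reading mesh `δ > 0`.
* FINITENESS: a random medial vertex is an edge of `Ω_δ`, so its base site lies in the finite `meshDomain`
  (`TotalSmall.finite_random`, landed); the three `finsum`s are `Finset.sum`s over `S = S_max`
  (`finsum_eq_sum_of_support_subset`).
* WEIGHTED GREEN (`stub_weightedGreen`, landed) over `S` for `F = cornerObs E δ`: its left side
  `Σ_{p ∈ S} conj(ẑ_p) · halfCRForm i p F` vanishes termwise by the half-CR vertex relation at every random
  vertex (`S2.halfCRLayer_of_dobrushinDomain`, landed; `halfCRRelationAt_iff`), whence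
  `((1+i)/4) · Σ_{internal} G = − momentSum`.
* BRIDGE (`stub_vertexCornerBridge_unfolded`, landed S1) at every `p ∈ S` (a random vertex touches no site of
  the arc `B`, so it is not an `A`–`B` edge): `2cos(π/12) · vertexObs = Σ_k G(p,k)`, and splitting `Σ_k` into
  internal and wall corners, `2cos(π/12) · totalVertexSum = Σ_{internal} G + wallPlainSum`.
* `4/(1+i) = 2(1−i)`.  [folklore]
-/

noncomputable section

namespace Summit.CriticalPhenomena.CardyFormulaZ2.Theorems.ParafermionFamiliesToSLESix.StripAnchored

open MeasureTheory Filter Set Metric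
open scoped Topology BigOperators
open Literature.Probability.LatticeModels (DiscreteDobrushin MedialVertex Site medialPoint medialExploration IsCorner
  zdGraph discreteDomainGraph)
open Literature.Probability.Percolation (bondPercolation half BondConfig)
open Literature.Probability.RandomPlanarGeometry (DobrushinDomain)
open Literature.Barriers.CriticalPhenomena (medialCornersAt medialVertexOf HalfCRRelationAt halfCRForm
  halfCRRelationAt_iff)
open Literature.Barriers.CriticalPhenomena.HalfCRGreen (coeff twin)
open Summit.CriticalPhenomena.CardyFormulaZ2.Theorems.ParafermionPrecompact.Negative (IsFamily VanishesOn)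
open Summit.CriticalPhenomena.CardyFormulaZ2.Cruxes.EdgePrecompact.QkzStripBoundaryArm (cornerObs)

namespace MomentIdentity

variable {E : DiscreteDobrushin} {δ : ℝ}

/-! ## Finiteness: the `finsum`s are finite sums over `S_max` (`TotalSmall.finite_random`, landed) -/

open Classical in
/-- A `finsum` of `if IsRandomMV E p then f p else 0` is the finite sum of `f` over any finite set `S` that is
exactly the set of random medial vertices. [folklore] -/
theorem finsum_ite_eq_sum (S : Finset (Site 2 × Fin 2)) (hS : ∀ p, p ∈ S ↔ IsRandomMV E p)
    (f : Site 2 × Fin 2 → ℂ) :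
    ∑ᶠ p : Site 2 × Fin 2, (if IsRandomMV E p then f p else 0) = ∑ p ∈ S, f p := by
  rw [finsum_eq_sum_of_support_subset (s := S)]
  · refine Finset.sum_congr rfl fun p hp => ?_
    rw [if_pos ((hS p).1 hp)]
  · intro p hp
    rw [Function.mem_support] at hp
    by_cases hc : IsRandomMV E p
    · exact Finset.mem_coe.2 ((hS p).2 hc)
    · exact absurd (if_neg hc) hp

/-! ## The identity over a finite set of random vertices -/

/-- `4/(1+i) = 2(1-i)`, in the form used: if `((1+i)/4) · X + M = 0` then `X = -2(1-i) · M`. [folklore] -/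
theorem internal_eq_of_green {X M : ℂ} (h : (1 + Complex.I) / 4 * X + M = 0) :
    X = -(2 * (1 - Complex.I)) * M := by
  linear_combination (2 * (1 - Complex.I)) * h + (X / 2) * Complex.I_sq

/-- **The moment identity for admissible data**, given the half-CR vertex relation (coefficient `i`) and the
vertex–corner bridge at every random both-faces-inner medial vertex, for the corner field read at mesh `δ`:
`2cos(π/12) · totalVertexSum E δ = wallPlainSum E δ − 2(1−i) · momentSum E δ`.  The `finsum`s are finite
sums over `S = S_max` (`finsum_ite_eq_sum`); the weighted Green identity (`stub_weightedGreen`) has vanishing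
left side by the half-CR relation, so `((1+i)/4) Σ_{internal} G = −momentSum`; the bridge summed over `S` and
split into internal and wall corners gives `2cos(π/12) · totalVertexSum = Σ_{internal} G + wallPlainSum`. [folklore] -/
theorem identity_of_halfCR_of_bridge (hE : E.IsZdAdmissible)
    (hCR : ∀ p, IsRandomMV E p → HalfCRRelationAt Complex.I (fun c : Site 2 × Site 2 => cornerObs E δ c.1 c.2) p)
    (hBr : ∀ p, IsRandomMV E p →
      ((2 * Real.cos (Real.pi / 12) : ℝ) : ℂ) * vertexObs E δ (medialVertexOf p) = ∑ k : Fin 4, G E δ p k) :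
    ((2 * Real.cos (Real.pi / 12) : ℝ) : ℂ) * totalVertexSum E δ =
      wallPlainSum E δ - 2 * (1 - Complex.I) * momentSum E δ := by
  classical
  -- the finite set of random vertices
  set S := (TotalSmall.finite_random hE).toFinset with hSdef
  have hS : ∀ p, p ∈ S ↔ IsRandomMV E p := fun p => Set.Finite.mem_toFinset _
  -- the three `finsum`s as finite sums over `S`, with the inner conditions read in `S`
  have hT : totalVertexSum E δ = ∑ p ∈ S, vertexObs E δ (medialVertexOf p) := by
    unfold totalVertexSum
    exact finsum_ite_eq_sum S hS _
  have hW : wallPlainSum E δ = ∑ p ∈ S, ∑ k : Fin 4, (if twin p.1 p.2 k ∈ S then 0 else G E δ p k) := by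
    unfold wallPlainSum
    rw [finsum_ite_eq_sum S hS]
    refine Finset.sum_congr rfl fun p _ => Finset.sum_congr rfl fun k _ => ?_
    by_cases h : IsRandomMV E (twin p.1 p.2 k)
    · rw [if_pos h, if_pos ((hS _).2 h)]
    · rw [if_neg h, if_neg (mt (hS _).1 h)]
  have hM : momentSum E δ = ∑ p ∈ S, ∑ k : Fin 4, (if twin p.1 p.2 k ∈ S then 0 else
      (starRingEnd ℂ) (medialPoint 1 (medialVertexOf p)) * coeff Complex.I k *
        (fun c : Site 2 × Site 2 => cornerObs E δ c.1 c.2) (medialCornersAt p.1 p.2 k)) := by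
    unfold momentSum
    rw [finsum_ite_eq_sum S hS]
    refine Finset.sum_congr rfl fun p _ => Finset.sum_congr rfl fun k _ => ?_
    by_cases h : IsRandomMV E (twin p.1 p.2 k)
    · rw [if_pos h, if_pos ((hS _).2 h)]
    · rw [if_neg h, if_neg (mt (hS _).1 h)]
      rfl
  -- the weighted Green identity over `S`, with vanishing left side (half-CR at every random vertex)
  have hGreen := stub_weightedGreen S (fun c : Site 2 × Site 2 => cornerObs E δ c.1 c.2)
  have hLHS : ∑ p ∈ S, (starRingEnd ℂ) (medialPoint 1 (medialVertexOf p)) *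
      halfCRForm Complex.I p (fun c : Site 2 × Site 2 => cornerObs E δ c.1 c.2) = 0 := by
    refine Finset.sum_eq_zero fun p hp => ?_
    rw [(halfCRRelationAt_iff _ _ _).1 (hCR p ((hS p).1 hp)), mul_zero]
  rw [hLHS, ← hM] at hGreen
  -- the internal sum
  set X : ℂ := ∑ p ∈ S, ∑ k : Fin 4, (if twin p.1 p.2 k ∈ S then
      (fun c : Site 2 × Site 2 => cornerObs E δ c.1 c.2) (medialCornersAt p.1 p.2 k) else 0) with hXdef
  have hX : X = -(2 * (1 - Complex.I)) * momentSum E δ := internal_eq_of_green hGreen.symm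
  -- the bridge summed over `S`, split into internal and wall corners
  have hTot : ((2 * Real.cos (Real.pi / 12) : ℝ) : ℂ) * totalVertexSum E δ = X + wallPlainSum E δ := by
    rw [hT, hW, hXdef, Finset.mul_sum, ← Finset.sum_add_distrib]
    refine Finset.sum_congr rfl fun p hp => ?_
    rw [hBr p ((hS p).1 hp), ← Finset.sum_add_distrib]
    refine Finset.sum_congr rfl fun k _ => ?_
    split_ifs
    · simp [G]
    · simp
  rw [hTot, hX]
  ring

/-- **The moment identity for admissible discretisations of a Dobrushin domain** (`E.Ω = D.carrier`, so the
inner faces are hole-free and the half-CR relation holds at every random vertex by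
`S2.halfCRLayer_of_dobrushinDomain`; the bridge `stub_vertexCornerBridge_unfolded` applies at every random
vertex since such a vertex touches no site of the discrete arc `B`, hence is not an `A`–`B` edge), at every
reading mesh `δ > 0`. [folklore] -/
theorem identity_of_dobrushinDomain (D : DobrushinDomain) (E : DiscreteDobrushin) (hΩ : E.Ω = D.carrier)
    (hE : E.IsZdAdmissible) (δ : ℝ) (hδ : 0 < δ) :
    ((2 * Real.cos (Real.pi / 12) : ℝ) : ℂ) * totalVertexSum E δ =
      wallPlainSum E δ - 2 * (1 - Complex.I) * momentSum E δ := by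
  refine identity_of_halfCR_of_bridge hE (fun p hp => S2.halfCRLayer_of_dobrushinDomain D E hΩ hE p hp δ hδ)
    (fun p hp => ?_)
  have hAB : medialVertexOf p ∉ E.zdABEdges := fun ⟨_, _, y, hy, hyB⟩ => hp.2.2.1 y hy hyB
  exact stub_vertexCornerBridge_unfolded E hE p hAB δ hδ

end MomentIdentity

/-- **Registered stub `stub_momentIdentity`** (line `strip-anchored-vertex-normalisation` r4 of
stmt-CriticalPhenomena-10814): the boundary first-moment identity along every discretisation family of every
Dobrushin domain, eventually in `δ` — as soon as `Λ δ` is admissible (`IsFamily` gives `(Λ δ).Ω = D.carrier` for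
all `δ` and admissibility eventually), by `MomentIdentity.identity_of_dobrushinDomain`. [folklore] -/
theorem stub_momentIdentity : ∀ (D : DobrushinDomain) (Λ : ℝ → DiscreteDobrushin), IsFamily D Λ → ∀ᶠ δ in 𝓝[>] (0:ℝ), ((2 * Real.cos (Real.pi / 12) : ℝ) : ℂ) * totalVertexSum (Λ δ) δ = wallPlainSum (Λ δ) δ - 2 * (1 - Complex.I) * momentSum (Λ δ) δ := by
  intro D Λ hΛ
  obtain ⟨hΩ, -, -, -, -, hadm⟩ := hΛ
  filter_upwards [hadm, self_mem_nhdsWithin] with δ hE hδ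
  exact MomentIdentity.identity_of_dobrushinDomain D (Λ δ) (hΩ δ) hE δ hδ

end Summit.CriticalPhenomena.CardyFormulaZ2.Theorems.ParafermionFamiliesToSLESix.StripAnchored

end
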